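import Mathlib
import Literature.Probability.Percolation.DiagonalStripExactGroundState
import Literature.Probability.Percolation.DiagonalStripPairingRecursion
import HarnessLib

/-!
# The sum `Z = Σ_Q P_Q` of the ground state: full symmetry, wheel zeros, and its recursion on `H_1`

Topic `Literature/Probability/Percolation`. Polynomial-level consequences for the sum `Z_L` of the
loop-weight-one ground state (Ikhlef–Ponsaing, J. Stat. Phys. 149 (2012), arXiv:1202.5476, §3.4–3.6),
which are the inputs of the normalisation `Z_L = χ_L(z²)` (Prop. 3.4):

* `rename_swap_eq_of_adjacent` — invariance under a transposition `(a b)` from invariance under the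
  adjacent transpositions `(i, i+1)`, `a ≤ i < b`;
* `sum_rename_swap_of_genSwap` — the `σ_i`-invariance of `Z` in the rapidity field
  (`DiagonalStripExactGroundState`) gives invariance of the POLYNOMIAL sum `Σ_Q P_Q` under every
  transposition of `{1, …, L}`;
* `wheelSubst q j` is avoided: the wheel zero at `(z_1, z_2, z_j) = (z, qz, q²z)` is stated through the
  explicit substitution `X_2 ↦ q X_1, X_j ↦ q² X_1` (`groundState_sum_wheel`), obtained from the wheel
  at `j = 3` (`DiagonalStripWheelVanishing`) by the transposition `(3 j)`;
* `degreeOf_hatRename_one` — `ẑ_1`-images do not involve `X_1, X_2`;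
* `groundState_sum_hyp_recursion` — IP12 (25) summed over the patterns, up to the scalar:
  `Φ_{k₀} · η_1(Σ_Q P_Q) = η_1(P_{k₀}) · ẑ_1(Σ_R P''_R)` with `Φ_{k₀} ≠ 0` free of `X_1, X_2`
  (so the recursion scalar `η_1(P_{k₀})/Φ_{k₀}` is a polynomial in `z_1` over `ℂ(w, z_3, …)`).

## References

* Y. Ikhlef, A. K. Ponsaing, *Finite-size left-passage probability in percolation*, J. Stat. Phys.
  149 (2012) 10–36, arXiv:1202.5476, §3.4 (25), §3.6 (27) and proof of Prop. 3.4. [IkhlefPonsaing2012]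
-/

namespace Literature.Probability.Percolation

open Finset Literature.Probability.LatticeModels Literature.Probability.LatticeModels.TemperleyLieb

/-! ### Transpositions from adjacent transpositions -/

section SwapChain

open MvPolynomial

variable {R : Type*} [CommSemiring R]

/-- Invariance under `(a b)` from invariance under the adjacent transpositions `(i, i+1)`, `a ≤ i < b`.
[folklore] -/
theorem rename_swap_eq_of_adjacent {f : MvPolynomial ℕ R} {a : ℕ} :
    ∀ b, a ≤ b → (∀ i, a ≤ i → i < b → rename (Equiv.swap i (i + 1)) f = f) →
      rename (Equiv.swap a b) f = f := by
  intro b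
  induction b with
  | zero =>
    intro ha _
    obtain rfl : a = 0 := by omega
    rw [Equiv.swap_self, Equiv.coe_refl, rename_id_apply]
  | succ b ih =>
    intro ha h
    rcases Nat.eq_or_lt_of_le ha with rfl | hlt
    · rw [Equiv.swap_self, Equiv.coe_refl, rename_id_apply]
    · have hab : a ≤ b := by omega
      rcases Nat.eq_or_lt_of_le hab with rfl | hlt'
      · exact h a le_rfl (by omega)
      · have ih' := ih hab fun i hi hib => h i hi (by omega)
        have hs := h b hab (by omega)
        have hperm : Equiv.swap a (b + 1) = Equiv.swap b (b + 1) * Equiv.swap a b * Equiv.swap b (b + 1) := by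
          rw [Equiv.swap_mul_swap_mul_swap (by omega : a ≠ b) (by omega : a ≠ b + 1), Equiv.swap_comm]
        rw [hperm, Equiv.Perm.coe_mul, Equiv.Perm.coe_mul, ← rename_rename, ← rename_rename, hs, ih', hs]

end SwapChain

/-! ### Full symmetry of the polynomial sum -/

section SumSymmetric

open MvPolynomial

variable {m : ℕ}

/-- **The polynomial sum `Σ_Q P_Q` is invariant under every transposition of `{1, …, L}`** when `Z`
is `σ_i`-invariant for `1 ≤ i ≤ 2m`. [cite: IkhlefPonsaing2012, proof of Prop. 3.4] -/
theorem sum_rename_swap_of_genSwap {P : ColPattern m → MvPolynomial ℕ ℂ}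
    (h : ∀ i, 1 ≤ i → i ≤ 2 * m → genSwap ℂ i (ipZsum fun Q => toRF ℂ (P Q)) = ipZsum fun Q => toRF ℂ (P Q))
    {a b : ℕ} (ha : 1 ≤ a) (hab : a ≤ b) (hb : b ≤ 2 * m + 1) :
    rename (Equiv.swap a b) (∑ Q, P Q) = ∑ Q, P Q := by
  have hZ : (ipZsum fun Q => toRF ℂ (P Q)) = toRF ℂ (∑ Q, P Q) := by unfold ipZsum; rw [map_sum]
  refine rename_swap_eq_of_adjacent b hab fun i hi hib => ?_
  apply toRF_injective
  rw [← genSwap_toRF, ← hZ]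
  exact h i (by omega) (by omega)

/-- **The exact ground state with a fully symmetric polynomial sum.** [cite: IkhlefPonsaing2012, §3.4, §3.6] -/
theorem exists_groundState_exact_sumSymmetric {q : ℂ} (hq : q ^ 2 + q + 1 = 0) :
    ∃ (P : ColPattern m → MvPolynomial ℕ ℂ) (a a' : ℤ), PolyPrimitive P ∧
      (∀ Q', ∑ Q, ipTransferMatrixW m (genC ℂ q) (genW ℂ) (genZ ℂ) Q Q' * toRF ℂ (P Q) = toRF ℂ (P Q')) ∧
      (∀ j' : Fin m, IsExactExchange q (2 * (j' : ℕ) + 1) (cpJoin (Fin.castSucc j') j'.succ) (fun Q => toRF ℂ (P Q))) ∧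
      (∀ b0 : Fin m, IsExactExchange q (2 * (b0 : ℕ) + 2) (cpIsolate b0.succ) (fun Q => toRF ℂ (P Q))) ∧
      (∀ Q, genInv ℂ (2 * m + 1) (toRF ℂ (P Q)) = genZ ℂ (2 * m + 1) ^ (2 * a) * toRF ℂ (P Q)) ∧
      (∀ Q, genInv ℂ 1 (toRF ℂ (P Q)) = genZ ℂ 1 ^ (2 * a') * toRF ℂ (P Q)) ∧
      (∀ a₁ b₁ : ℕ, 1 ≤ a₁ → a₁ ≤ b₁ → b₁ ≤ 2 * m + 1 → rename (Equiv.swap a₁ b₁) (∑ Q, P Q) = ∑ Q, P Q) := by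
  obtain ⟨P, a, a', hprim, hP, hodd, heven, htop, hbot, hswap, -, -⟩ := exists_groundState_exact_symmetric (m := m) hq
  exact ⟨P, a, a', hprim, hP, hodd, heven, htop, hbot, fun a₁ b₁ h1 h2 h3 => sum_rename_swap_of_genSwap hswap h1 h2 h3⟩

end SumSymmetric

/-! ### Wheel zeros of the sum at `(z_1, z_2, z_j) = (z, q z, q² z)` -/

section WheelSum

open MvPolynomial

variable {n : ℕ}

/-- The substitution `X_2 ↦ q X_1`, `X_j ↦ q² X_1` is the `(3 j)`-conjugate of `η_1 ∘ η_2`. [folklore] -/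
theorem aeval_wheel_eq_conj (q : ℂ) {j : ℕ} (hj : 3 ≤ j) :
    (aeval (R := ℂ) fun k : ℕ => if k = 2 then C q * X 1 else if k = j then C (q ^ 2) * X 1 else
        (X k : MvPolynomial ℕ ℂ)).toRingHom =
      (rename (Equiv.swap 3 j)).toRingHom.comp (((hypSubst q 1).comp (hypSubst q 2)).comp
        (rename (Equiv.swap 3 j)).toRingHom) := by
  refine ringHom_ext (fun c => ?_) (fun k => ?_)
  · simp only [AlgHom.toRingHom_eq_coe, RingHom.coe_coe, RingHom.comp_apply, hypSubst_C, algHom_C,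
      algebraMap_eq]
  · have e3 : hypSubst q 2 (X 3 : MvPolynomial ℕ ℂ) = C q * X 2 := hypSubst_X_self q 2
    have e2 : hypSubst q 1 (X 2 : MvPolynomial ℕ ℂ) = C q * X 1 := hypSubst_X_self q 1
    have e2' : hypSubst q 2 (X 2 : MvPolynomial ℕ ℂ) = X 2 := hypSubst_X_of_ne q (by omega)
    have e1 : hypSubst q 1 (X 1 : MvPolynomial ℕ ℂ) = X 1 := hypSubst_X_of_ne q (by omega)
    have e1' : hypSubst q 2 (X 1 : MvPolynomial ℕ ℂ) = X 1 := hypSubst_X_of_ne q (by omega)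
    simp only [AlgHom.toRingHom_eq_coe, RingHom.coe_coe, RingHom.comp_apply, aeval_X, rename_X]
    by_cases hk2 : k = 2
    · subst hk2
      rw [if_pos rfl, Equiv.swap_apply_of_ne_of_ne (by omega) (by omega), e2', e2, map_mul, rename_C, rename_X,
        Equiv.swap_apply_of_ne_of_ne (by omega) (by omega)]
    rw [if_neg hk2]
    by_cases hkj : k = j
    · subst hkj
      rw [if_pos rfl, Equiv.swap_apply_right, e3, map_mul, hypSubst_C, e2, map_mul, rename_C, map_mul, rename_C,
        rename_X, Equiv.swap_apply_of_ne_of_ne (by omega) (by omega), sq, map_mul, mul_assoc]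
    rw [if_neg hkj]
    by_cases hk3 : k = 3
    · subst hk3
      rw [Equiv.swap_apply_left, hypSubst_X_of_ne q (show j ≠ 2 + 1 by omega),
        hypSubst_X_of_ne q (show j ≠ 1 + 1 by omega), rename_X, Equiv.swap_apply_right]
    · rw [Equiv.swap_apply_of_ne_of_ne hk3 hkj, hypSubst_X_of_ne q (show k ≠ 2 + 1 by omega),
        hypSubst_X_of_ne q (show k ≠ 1 + 1 by omega), rename_X, Equiv.swap_apply_of_ne_of_ne hk3 hkj]

/-- **Wheel zeros of the sum**: for a polynomial `t`-fixed vector whose sum is invariant under the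
transposition `(3 j)`, `3 ≤ j ≤ L`, the sum vanishes under `z_2 = q z_1, z_j = q² z_1`.
[cite: IkhlefPonsaing2012, §3.4–3.6] -/
theorem groundState_sum_wheel {q : ℂ} (hq : q ^ 2 + q + 1 = 0) {P : ColPattern (n + 1) → MvPolynomial ℕ ℂ}
    (hP : ∀ Q', ∑ Q, ipTransferMatrixW (n + 1) (genC ℂ q) (genW ℂ) (genZ ℂ) Q Q' * toRF ℂ (P Q) = toRF ℂ (P Q'))
    {j : ℕ} (hj : 3 ≤ j) (hsym : rename (Equiv.swap 3 j) (∑ Q, P Q) = ∑ Q, P Q) :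
    aeval (fun k : ℕ => if k = 2 then C q * X 1 else if k = j then C (q ^ 2) * X 1 else (X k : MvPolynomial ℕ ℂ))
      (∑ Q, P Q) = 0 := by
  have h := RingHom.congr_fun (aeval_wheel_eq_conj q hj) (∑ Q, P Q)
  simp only [AlgHom.toRingHom_eq_coe, RingHom.coe_coe, RingHom.comp_apply] at h
  rw [h, hsym, hypSubst_wheel_ipZsum hq hP, map_zero]

end WheelSum

/-! ### The recursion of the sum on `H_1`, up to the scalar -/

section SumRecursion

open MvPolynomial

variable {n : ℕ}

/-- `ẑ_1`-images do not involve `X_1, X_2`. [folklore] -/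
theorem degreeOf_hatRename_one (f : MvPolynomial ℕ ℂ) {k : ℕ} (hk : k = 1 ∨ k = 2) :
    (hatRename 1 f).degreeOf k = 0 := by
  classical
  by_contra h
  have hmem := mem_vars_iff_degreeOf_ne_zero.2 h
  have hsub := vars_rename (fun k : ℕ => if k < 1 then k else k + 2) f
  unfold hatRename at hmem
  rw [AlgHom.toRingHom_eq_coe, RingHom.coe_coe] at hmem
  obtain ⟨k', -, hk'⟩ := Finset.mem_image.1 (hsub hmem)
  split_ifs at hk' with h1 <;> omega

/-- **IP12 (25) for the sum, up to the scalar**: with `Φ_{k₀} = Σ_{φ_1 R = k₀} ẑ_1 P''_R ≠ 0` (free of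
`X_1, X_2`), `Φ_{k₀} · η_1(Σ_Q P_Q) = η_1(P_{k₀}) · ẑ_1(Σ_R P''_R)`. [cite: IkhlefPonsaing2012, (25), (27)] -/
theorem groundState_sum_hyp_recursion {q : ℂ} (hq : q ^ 2 + q + 1 = 0) {P : ColPattern (n + 1) → MvPolynomial ℕ ℂ}
    (hP : ∀ Q', ∑ Q, ipTransferMatrixW (n + 1) (genC ℂ q) (genW ℂ) (genZ ℂ) Q Q' * toRF ℂ (P Q) = toRF ℂ (P Q'))
    {P'' : ColPattern n → MvPolynomial ℕ ℂ} (hP''0 : P'' ≠ 0)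
    (hP'' : ∀ Q', ∑ Q, ipTransferMatrixW n (genC ℂ q) (genW ℂ) (genZ ℂ) Q Q' * toRF ℂ (P'' Q) = toRF ℂ (P'' Q')) :
    ∃ k₀ : ColPattern (n + 1),
      (∑ R ∈ Finset.univ.filter (fun R => cpInsDup 0 R = k₀), hatRename 1 (P'' R)) ≠ 0 ∧
      (∑ R ∈ Finset.univ.filter (fun R => cpInsDup 0 R = k₀), hatRename 1 (P'' R)) * hypSubst q 1 (∑ Q, P Q) =
        hypSubst q 1 (P k₀) * hatRename 1 (∑ R, P'' R) := by
  classical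
  set Φ₁ : ColPattern (n + 1) → MvPolynomial ℕ ℂ := fun Q =>
    ∑ R ∈ Finset.univ.filter (fun R => cpInsDup 0 R = Q), hatRename 1 (P'' R) with hΦ₁
  obtain ⟨k₀, hk₀⟩ : ∃ k₀, Φ₁ k₀ ≠ 0 := by
    have h := pushforward_cpInsDup_ne_zero hq (0 : Fin (n + 1)) hP''0
    simp only [Fin.val_zero, mul_zero, zero_add] at h
    by_contra hall; push Not at hall
    exact h (funext fun Q => by rw [Pi.zero_apply, ← map_sum, show (∑ R ∈ Finset.univ.filter
      (fun R => cpInsDup 0 R = Q), hatRename 1 (P'' R)) = Φ₁ Q from rfl, hall Q, map_zero])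
  have I1 : ∀ Q, Φ₁ k₀ * hypSubst q 1 (P Q) = hypSubst q 1 (P k₀) * Φ₁ Q := by
    intro Q
    have h := congrFun (groundState_hyp_recursion_odd hq (0 : Fin (n + 1)) hP hP'' k₀) Q
    simp only [Fin.val_zero, mul_zero, zero_add, Pi.smul_apply, smul_eq_mul] at h
    apply toRF_injective
    rw [map_mul, map_mul, hΦ₁]; simp only [map_sum]
    exact h
  refine ⟨k₀, hk₀, ?_⟩
  show Φ₁ k₀ * hypSubst q 1 (∑ Q, P Q) = hypSubst q 1 (P k₀) * hatRename 1 (∑ R, P'' R)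
  rw [map_sum, Finset.mul_sum, Finset.sum_congr rfl fun Q _ => I1 Q, ← Finset.mul_sum, map_sum]
  congr 1
  exact sum_fiber_total (fun R => cpInsDup 0 R) fun R => hatRename 1 (P'' R)

end SumRecursion

end Literature.Probability.Percolation
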